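import Summits.QuantumFields.YangMills.Theses.ParabolicTrajectory
import Literature.MathematicalPhysics.QuantumFieldTheory.LatticeGaugeProofs

/-!
# Junk charts for `BalabanBanachStep` at the trivial gauge group, and tightness of stub 1 (`UVPassage`) of the
skeleton `dissipative-bridge` of crux `LatticeGapOnTrajectory` (stmt-QuantumFields-10523)

Refuter (cdisprove gen 3) negative-knowledge file, supporting the crux item; no route statement is asserted.

* `junkStep r b` (any `[Subsingleton G]`, `M = 2`): a one-parameter family of inhabitants of the hypothesis structure
  `Literature.MathematicalPhysics.QuantumFieldTheory.BalabanBanachStep G r 2` — `E = ℝ`, `φ g y = g + g³ (b − y)`,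
  `Ψ g y = g²`, `C = 3`, `δ = R = 1`, `yW ≡ 0`, `β(g) = 1/g²`, realisation functional `[n = 0]` (at the trivial
  group every lattice field is a centred constant: `wilsonCentredSchwinger_of_subsingleton`). So every `∀ G`-stub
  over `BalabanBanachStep` (e.g. `UVPassage`, `ScaleAnchoring`, `LatticeToTransfer` of
  `Cruxes/LatticeGapOnTrajectory/Lines/dissipative-bridge.lean`, sha 4ba1ce0c…) ranges over a NON-EMPTY class of charts
  before the route crux `BalabanStepParabolic` (stmt-QuantumFields-9684) is inhabited, and can be junk-tested here.
* The dynamics `g' = g + g³(1/100 − y)`, `y' = g²` stalls: `StallInv` is invariant (`stallInv_orbit`), the coupling of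
  a Wilson orbit started below `1/20` never exceeds `3/25`.
* `uvPassage_false_without_drift`, `uvPassage_false_without_absorption`: the skeleton's stub 1 `UVPassage` with the
  DRIFT conjunct `C (γ⁺ + ρ) ≤ b/2`, resp. the ABSORPTION conjunct `2 C γ⁺² ≤ (1 − θ') ρ`, dropped from
  `TubeAdmissible` is FALSE (statements restated inline; `InChart`, `tubeTop`, `Tube` are verbatim copies of the
  skeleton's, namespace `…Negative.DB`). Any proof of `stub_uvPassage` must use both conjuncts.
-/

namespace Summit.QuantumFields.YangMills.Theorems.LatticeGapOnTrajectory.Negative.DB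

open Filter Topology MeasureTheory
open Literature.MathematicalPhysics.AQFT Literature.MathematicalPhysics.QuantumLattice
open Literature.Probability.LatticeModels
open Literature.MathematicalPhysics.QuantumFieldTheory

noncomputable section

section ChartCopies

variable {G : Type} [Group G] [TopologicalSpace G] [IsTopologicalGroup G] [CompactSpace G]
  [MeasurableSpace G] [BorelSpace G] {r : LatticeRep G} {M : ℕ} (S : BalabanBanachStep G r M)

/-- COPY of `DissipativeBridge.InChart`. [folklore] -/
def InChart (p : ℝ × S.E) (j : ℕ) : Prop :=
  ∀ l ≤ j, (S.F^[l] p).1 ∈ Set.Icc 0 S.δ ∧ ‖(S.F^[l] p).2‖ ≤ S.R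

/-- COPY of `DissipativeBridge.tubeTop`. [folklore] -/
def tubeTop (γ : ℝ) : ℝ := γ + (S.b + S.C * (S.δ + S.R)) * γ ^ 3

/-- COPY of `DissipativeBridge.Tube`. [folklore] -/
def Tube (γ ρ : ℝ) : Set (ℝ × S.E) :=
  {p | γ ≤ p.1 ∧ p.1 ≤ tubeTop S γ ∧ ‖p.2‖ ≤ ρ}

end ChartCopies

section TrivialGroup

variable {G : Type} [Group G] [TopologicalSpace G] [IsTopologicalGroup G] [CompactSpace G]
  [MeasurableSpace G] [BorelSpace G]

/-- At the trivial group the torus Wilson mean of an observable is its (constant) value. [folklore] -/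
theorem wilsonTorusMean_of_subsingleton [Subsingleton G] {N : ℕ} (ρ : G →* Matrix (Fin N) (Fin N) ℂ)
    (hρ : Continuous ρ) (β : ℝ) (L : ℕ) (O : LGConfig 4 G → ℝ) :
    wilsonTorusMean ρ β L O = O 1 := by
  haveI := isProbabilityMeasure_wilsonMeasure (d := 4) (L := 2 * L + 1) ρ hρ β
  unfold wilsonTorusMean
  have : (fun U : GaugeConfig 4 (2 * L + 1) G => O (torusLift (2 * L + 1) U)) = fun _ => O 1 :=
    funext fun U => congrArg O (Subsingleton.elim _ _)
  rw [this, integral_const, smul_eq_mul, probReal_univ, one_mul]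

/-- At the trivial group the centred unit-lattice Wilson `n`-point functions are `1` for `n = 0` and `0`
otherwise (every centred field vanishes identically). [folklore] -/
theorem wilsonCentredSchwinger_of_subsingleton [Subsingleton G] {N : ℕ} (ρ : G →* Matrix (Fin N) (Fin N) ℂ)
    (hρ : Continuous ρ) (β : ℝ) (L : ℕ) (c : YMSpecies G → ℝ) (n : ℕ) (σ : Fin n → YMSpecies G)
    (f : Fin n → SchwartzMap (EuclideanSpace ℝ (Fin 4)) ℝ) :
    wilsonCentredSchwinger ρ β L c n σ f = if n = 0 then 1 else 0 := by
  haveI := isProbabilityMeasure_wilsonMeasure (d := 4) (L := 2 * L + 1) ρ hρ β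
  rcases Nat.eq_zero_or_pos n with rfl | hn
  · rw [wilsonCentredSchwinger_zero, if_pos rfl, probReal_univ]
  · rw [if_neg hn.ne']
    unfold wilsonCentredSchwinger
    have hzero : ∀ U : GaugeConfig 4 (2 * L + 1) G,
        (∏ i, smearedLatticeField (σ i).F (box 4 L) 1 (c (σ i)) (wilsonTorusMean ρ β L (σ i).F) (f i)
          (torusLift (2 * L + 1) U)) = 0 := by
      intro U
      refine Finset.prod_eq_zero (Finset.mem_univ (⟨0, hn⟩ : Fin n)) ?_
      unfold smearedLatticeField
      rw [wilsonTorusMean_of_subsingleton ρ hρ β L]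
      have hs : ∑ x ∈ box 4 L, f ⟨0, hn⟩ ((1 : ℝ) • siteToE x) *
          ((σ ⟨0, hn⟩).F (configShift (-x) (torusLift (2 * L + 1) U)) - (σ ⟨0, hn⟩).F 1) = 0 := by
        refine Finset.sum_eq_zero fun x _ => ?_
        rw [congrArg (σ ⟨0, hn⟩).F (Subsingleton.elim (configShift (-x) (torusLift (2 * L + 1) U)) 1),
          sub_self, mul_zero]
      rw [hs, mul_zero]
    simp only [hzero, integral_zero]

/-- The zero operator on `ℝ` applied to anything is `0`. [folklore] -/
theorem hzeroCLM (y : ℝ) : (0 : ℝ →L[ℝ] ℝ) y = 0 := rfl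

/-- **A one-parameter family of junk charts at the trivial group** (`M = 2`, `E = ℝ`, `C = 3`, `δ = R = 1`,
`θ = θ' = 0`, `yW ≡ 0`): coupling step `φ g y = g + g³ (b − y)` — the fibre coordinate FEEDS BACK into the drift
with the maximal strength the remainder bounds allow — and fibre step `Ψ g y = g²`. All axioms of
`BalabanBanachStep` hold (the realisation functional is the constant `[n = 0]`, lattice fields being centred
constants). Its dynamics `g' = g + g³(b − y)`, `y' = g²` has the circle of fixed points `g² = b`, attracting from
below: the running coupling STALLS at `√b`. [folklore] -/
abbrev junkStep [Subsingleton G] (r : LatticeRep G) (b : ℝ) (hb : 0 < b) : BalabanBanachStep G r 2 where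
  E := ℝ
  φ := fun g y => g + g ^ 3 * (b - y)
  Ψ := fun g _ => g ^ 2
  A := 0
  b := b
  θ := 0
  C := 3
  δ := 1
  b_pos := hb
  θ_nonneg := le_rfl
  θ_lt_one := zero_lt_one
  C_pos := by norm_num
  δ_pos := zero_lt_one
  norm_A_le := by simp
  remainder := fun g y _ _ => by
    constructor
    · have h1 : g + g ^ 3 * (b - y) - (g + b * g ^ 3) = -(g ^ 3 * y) := by ring
      rw [h1, abs_neg, abs_mul, abs_pow, Real.norm_eq_abs]
      have h4 : 0 ≤ g ^ 4 := by positivity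
      have h5 : 0 ≤ |g| ^ 3 * |y| := by positivity
      linarith
    · rw [hzeroCLM, sub_zero, Real.norm_eq_abs, abs_of_nonneg (sq_nonneg g), Real.norm_eq_abs, sq_abs]
      nlinarith [sq_nonneg g, sq_nonneg y]
  lipschitz_fibre := fun g y y' _ _ _ => by
    constructor
    · have h1 : g + g ^ 3 * (b - y) - (g + g ^ 3 * (b - y')) = -(g ^ 3 * (y - y')) := by ring
      rw [h1, abs_neg, abs_mul, abs_pow, Real.norm_eq_abs]
      nlinarith [mul_nonneg (pow_nonneg (abs_nonneg g) 3) (abs_nonneg (y - y'))]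
    · rw [hzeroCLM, sub_self, sub_zero, norm_zero]
      positivity
  lipschitz_base := fun g g' y _ _ _ => by
    constructor
    · set m : ℝ := max |g| |g'| with hm
      have hgm : |g| ≤ m := le_max_left _ _
      have hgm' : |g'| ≤ m := le_max_right _ _
      have hm0 : 0 ≤ m := (abs_nonneg g).trans hgm
      have h1 : g + g ^ 3 * (b - y) - (g' + g' ^ 3 * (b - y)) - (g - g') - b * (g ^ 3 - g' ^ 3) =
          -(y * (g ^ 3 - g' ^ 3)) := by ring
      have h3 : |g ^ 3 - g' ^ 3| ≤ 3 * m ^ 2 * |g - g'| := by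
        have h2 : g ^ 3 - g' ^ 3 = (g - g') * (g ^ 2 + g * g' + g' ^ 2) := by ring
        rw [h2, abs_mul]
        have hq : |g ^ 2 + g * g' + g' ^ 2| ≤ 3 * m ^ 2 := by
          calc |g ^ 2 + g * g' + g' ^ 2| ≤ |g ^ 2| + |g * g'| + |g' ^ 2| := abs_add_three _ _ _
            _ = |g| ^ 2 + |g| * |g'| + |g'| ^ 2 := by rw [abs_pow, abs_mul, abs_pow]
            _ ≤ m ^ 2 + m * m + m ^ 2 := by gcongr
            _ = 3 * m ^ 2 := by ring
        calc |g - g'| * |g ^ 2 + g * g' + g' ^ 2| ≤ |g - g'| * (3 * m ^ 2) :=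
              mul_le_mul_of_nonneg_left hq (abs_nonneg _)
          _ = 3 * m ^ 2 * |g - g'| := by ring
      rw [h1, abs_neg, abs_mul, Real.norm_eq_abs]
      calc |y| * |g ^ 3 - g' ^ 3| ≤ |y| * (3 * m ^ 2 * |g - g'|) :=
            mul_le_mul_of_nonneg_left h3 (abs_nonneg y)
        _ ≤ 3 * m ^ 2 * (m + |y|) * |g - g'| := by
            nlinarith [mul_nonneg (mul_nonneg (sq_nonneg m) hm0) (abs_nonneg (g - g')), abs_nonneg y]
    · rw [Real.norm_eq_abs, show g ^ 2 - g' ^ 2 = (g + g') * (g - g') by ring, abs_mul]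
      calc |g + g'| * |g - g'| ≤ (|g| + |g'|) * |g - g'| :=
            mul_le_mul_of_nonneg_right (abs_add_le _ _) (abs_nonneg _)
        _ ≤ 3 * (|g| + |g'| + ‖y‖) * |g - g'| := by
            nlinarith [abs_nonneg g, abs_nonneg g', norm_nonneg y, abs_nonneg (g - g'),
              mul_nonneg (add_nonneg (add_nonneg (abs_nonneg g) (abs_nonneg g')) (norm_nonneg y))
                (abs_nonneg (g - g'))]
  b₀ := b / Real.log 2
  b_eq := (div_mul_cancel₀ b (Real.log_pos one_lt_two).ne').symm
  R := 1
  δ_le_R := le_rfl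
  θ' := 0
  θ'_nonneg := le_rfl
  θ'_lt_one := zero_lt_one
  contraction := fun _ _ _ _ _ _ => by simp
  remainder_basin := fun g y _ _ => by
    have h1 : g + g ^ 3 * (b - y) - (g + b * g ^ 3) = -(g ^ 3 * y) := by ring
    rw [h1, abs_neg, abs_mul, abs_pow, Real.norm_eq_abs]
    have h4 : 0 ≤ g ^ 4 := by positivity
    have h5 : 0 ≤ |g| ^ 3 * |y| := by positivity
    linarith
  yW := fun _ => 0
  g₀ := 1
  g₀_pos := zero_lt_one
  continuousOn_yW := continuousOn_const
  norm_yW_le := fun _ _ => by simp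
  betaOf := fun g => 1 / g ^ 2
  strictAntiOn_betaOf := fun a ha b hb hab =>
    one_div_lt_one_div_of_lt (pow_pos ha.1 2) (by nlinarith [ha.1, hb.1])
  continuousOn_betaOf :=
    continuousOn_const.div (continuousOn_pow 2) fun x hx => (pow_pos hx.1 2).ne'
  κ := 1
  κ_pos := zero_lt_one
  K := 0
  betaOf_sub_le := fun g _ => by simp
  c := fun _ _ => 1
  c_curvature := fun _ => rfl
  expect := fun _ _ n _ _ => if n = 0 then 1 else 0
  expect_step := fun _ _ _ _ _ _ _ _ => rfl
  expect_wilson := fun g _ L n σ f => (wilsonCentredSchwinger_of_subsingleton r.ρ r.continuous _ L _ n σ f).symm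
  continuousOn_expect := fun _ _ _ _ _ => continuousOn_const

section JunkDynamics

variable [Subsingleton G] (r : LatticeRep G) {b : ℝ} (hb : 0 < b)

/-- The junk step in coordinates. [folklore] -/
@[simp] theorem junkStep_F (g y : ℝ) :
    (junkStep r b hb).F (g, y) = (g + g ^ 3 * (b - y), g ^ 2) := rfl

/-- The Wilson embedding of the junk chart is `0`. [folklore] -/
@[simp] theorem junkStep_yW (g : ℝ) : (junkStep r b hb).yW g = 0 := rfl

/-- The fibre coordinate of every junk orbit started at a Wilson point is non-negative. [folklore] -/
theorem junk_snd_nonneg (g : ℝ) : ∀ l : ℕ, 0 ≤ ((junkStep r b hb).F^[l] (g, 0)).2 := by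
  intro l
  induction l with
  | zero => simp
  | succ l ih =>
    rw [Function.iterate_succ_apply']
    set p := (junkStep r b hb).F^[l] (g, 0)
    change 0 ≤ ((junkStep r b hb).F (p.1, p.2)).2
    rw [junkStep_F]
    exact sq_nonneg _

end JunkDynamics

/-- `TubeAdmissible` with the DRIFT condition `C (γ⁺ + ρ) ≤ b/2` dropped. [folklore] -/
def TubeAdmissibleNoDrift {r : LatticeRep G} {M : ℕ} (S : BalabanBanachStep G r M) (γ ρ : ℝ) : Prop :=
  0 < γ ∧ 0 < ρ ∧ ρ ≤ S.R ∧ tubeTop S γ ≤ S.δ ∧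
  2 * S.C * (tubeTop S γ) ^ 2 ≤ (1 - S.θ') * ρ ∧
  S.C * (tubeTop S γ + S.R) * (tubeTop S γ) ^ 2 ≤ 1 / 2

/-- `TubeAdmissible` with the ABSORPTION condition `2 C γ⁺² ≤ (1 − θ') ρ` dropped. [folklore] -/
def TubeAdmissibleNoAbsorption {r : LatticeRep G} {M : ℕ} (S : BalabanBanachStep G r M) (γ ρ : ℝ) : Prop :=
  0 < γ ∧ 0 < ρ ∧ ρ ≤ S.R ∧ tubeTop S γ ≤ S.δ ∧
  S.C * (tubeTop S γ + ρ) ≤ S.b / 2 ∧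
  S.C * (tubeTop S γ + S.R) * (tubeTop S γ) ^ 2 ≤ 1 / 2

/-- The trivial lattice representation of the trivial group `Unit`. [folklore] -/
def unitRep : LatticeRep Unit where
  N := 1
  ρ := 1
  continuous := continuous_const
  injective := fun a b _ => Subsingleton.elim a b
  mem_unitary := fun _ => Submonoid.one_mem _

section Stall

/-- The stalling invariant of the junk dynamics at `b = 1/100`: `0 ≤ g ≤ 3/25`, `0 ≤ y ≤ 1`, and
`g ≥ 101/1000 ⇒ y ≥ 1/100` (the drift is then `≤ 0`). [folklore] -/
def StallInv (p : ℝ × ℝ) : Prop :=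
  0 ≤ p.1 ∧ p.1 ≤ 3 / 25 ∧ 0 ≤ p.2 ∧ p.2 ≤ 1 ∧ (101 / 1000 ≤ p.1 → 1 / 100 ≤ p.2)

/-- The stalling invariant is preserved by the junk step `g' = g + g³(1/100 − y)`, `y' = g²`. [folklore] -/
theorem stallInv_step {g y : ℝ} (h : StallInv (g, y)) :
    StallInv (g + g ^ 3 * (1 / 100 - y), g ^ 2) := by
  obtain ⟨hg0, hg1, hy0, hy1, himp⟩ := h
  simp only at hg0 hg1 hy0 hy1 himp
  have hg3 : 0 ≤ g ^ 3 := by positivity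
  have hg2 : g ^ 2 ≤ 9 / 625 := by nlinarith
  refine ⟨?_, ?_, ?_, ?_, ?_⟩
  · show 0 ≤ g + g ^ 3 * (1 / 100 - y)
    nlinarith [mul_nonneg hg3 (sub_nonneg.2 hy1), mul_le_mul_of_nonneg_left hg2 hg0]
  · show g + g ^ 3 * (1 / 100 - y) ≤ 3 / 25
    by_cases hc : 101 / 1000 ≤ g
    · have hy := himp hc
      have : g ^ 3 * (1 / 100 - y) ≤ 0 := mul_nonpos_of_nonneg_of_nonpos hg3 (by linarith)
      linarith
    · push Not at hc
      have hp := pow_le_pow_left₀ hg0 hc.le 3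
      nlinarith [mul_nonneg hg3 hy0]
  · show 0 ≤ g ^ 2
    exact sq_nonneg g
  · show g ^ 2 ≤ 1
    nlinarith
  · intro hc
    show 1 / 100 ≤ g ^ 2
    by_contra hlt
    push Not at hlt
    have hg10 : g < 1 / 10 := by
      by_contra h'
      push Not at h'
      nlinarith [mul_le_mul h' h' (by norm_num) hg0]
    have hp := pow_le_pow_left₀ hg0 hg10.le 3
    have : g + g ^ 3 * (1 / 100 - y) < 101 / 1000 := by nlinarith [mul_nonneg hg3 hy0]
    exact absurd hc (not_le.2 this)

/-- Every junk orbit (`b = 1/100`) started at a Wilson point `g ≤ 1/20` satisfies the stalling invariant for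
ever; in particular its coupling never exceeds `3/25` and both coordinates stay non-negative. [folklore] -/
theorem stallInv_orbit (r : LatticeRep Unit) {g : ℝ} (hg0 : 0 ≤ g) (hg1 : g ≤ 1 / 20) (l : ℕ) :
    StallInv ((junkStep r (1 / 100) (by norm_num)).F^[l] (g, 0)) := by
  induction l with
  | zero =>
    refine ⟨hg0, ?_, le_rfl, ?_, fun h => ?_⟩
    · show g ≤ 3 / 25
      linarith
    · show (0 : ℝ) ≤ 1
      norm_num
    · change (101 / 1000 : ℝ) ≤ g at h
      linarith
  | succ l ih =>
    rw [Function.iterate_succ_apply']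
    set p := (junkStep r (1 / 100) (by norm_num)).F^[l] (g, 0)
    change StallInv ((junkStep r (1 / 100) (by norm_num)).F (p.1, p.2))
    rw [junkStep_F]
    exact stallInv_step ih

/-- **The drift condition is load-bearing for stub 1.** Without `C (γ⁺ + ρ) ≤ b/2` in `TubeAdmissible`,
the skeleton's stub statement `UVPassage` (restated inline below with the weakened admissibility) is FALSE: in the junk chart `junkStep (b := 1/100)` at the trivial group the tube `γ = 1/5`,
`ρ = 1/2` satisfies every other admissibility condition, but every Wilson orbit started below `1/20` stalls
under the attracting fixed circle `g = 1/10 < γ` (`stallInv_orbit`) and never enters the tube. So any proof of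
`stub_uvPassage` must use the drift condition (it is what places all fixed points of the chart dynamics ABOVE
the tube). [folklore] -/
theorem uvPassage_false_without_drift :
    ¬ (∀ (G : Type) [Group G] [TopologicalSpace G] [IsTopologicalGroup G] [CompactSpace G]
        [MeasurableSpace G] [BorelSpace G] (r : LatticeRep G) (M : ℕ) (S : BalabanBanachStep G r M)
        (γ ρ : ℝ), TubeAdmissibleNoDrift S γ ρ →
        ∃ g₁ : ℝ, 0 < g₁ ∧ g₁ ≤ S.g₀ ∧ ∀ g ∈ Set.Ioc 0 g₁, ∃ j : ℕ,
          S.F^[j] (g, S.yW g) ∈ Tube S γ ρ ∧ InChart S (g, S.yW g) j ∧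
          ∀ l < j, (S.F^[l] (g, S.yW g)).1 < γ) := by
  intro h
  have hadm : TubeAdmissibleNoDrift (junkStep unitRep (1 / 100) (by norm_num)) (1 / 5) (1 / 2) := by
    refine ⟨by norm_num, by norm_num, ?_, ?_, ?_, ?_⟩ <;> norm_num [tubeTop, junkStep]
  obtain ⟨g₁, hg₁, -, hpass⟩ :=
    h Unit unitRep 2 (junkStep unitRep (1 / 100) (by norm_num)) (1 / 5) (1 / 2) hadm
  set g : ℝ := min g₁ (1 / 20) with hgdef
  have hg : g ∈ Set.Ioc 0 g₁ := ⟨lt_min hg₁ (by norm_num), min_le_left _ _⟩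
  obtain ⟨j, hjT, -, -⟩ := hpass g hg
  have hinv := stallInv_orbit unitRep hg.1.le (min_le_right _ _) j
  have h1 : (1 / 5 : ℝ) ≤ ((junkStep unitRep (1 / 100) (by norm_num)).F^[j] (g, 0)).1 := hjT.1
  have h2 := hinv.2.1
  linarith

end Stall

section Thin

/-- **The absorption condition is load-bearing for stub 1.** Without `2 C γ⁺² ≤ (1 − θ') ρ`, the skeleton's
stub statement `UVPassage` (restated inline) is FALSE: in the same junk chart `junkStep (b := 1/100)` the THIN tube `γ = 10⁻³`, `ρ = 10⁻⁷` satisfies every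
other admissibility condition (drift included: `3 (γ⁺ + ρ) ≤ 1/200`); orbits started below `1/2000` are tame
(`stallInv_orbit`: `0 ≤ g`, `0 ≤ y`), and at any step `l + 1` with `g_{l+1} ≥ 10⁻³` the previous coupling was
`≥ 1/3000` (one step moves `g` by at most `g³/100`), so the fibre coordinate `y_{l+1} = g_l² > 10⁻⁷ = ρ`: the
orbit crosses the window `[γ, γ⁺]` OUTSIDE the thin tube (the fibre is not yet absorbed). So any proof of
`stub_uvPassage` must use the absorption condition. [folklore] -/
theorem uvPassage_false_without_absorption :
    ¬ (∀ (G : Type) [Group G] [TopologicalSpace G] [IsTopologicalGroup G] [CompactSpace G]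
        [MeasurableSpace G] [BorelSpace G] (r : LatticeRep G) (M : ℕ) (S : BalabanBanachStep G r M)
        (γ ρ : ℝ), TubeAdmissibleNoAbsorption S γ ρ →
        ∃ g₁ : ℝ, 0 < g₁ ∧ g₁ ≤ S.g₀ ∧ ∀ g ∈ Set.Ioc 0 g₁, ∃ j : ℕ,
          S.F^[j] (g, S.yW g) ∈ Tube S γ ρ ∧ InChart S (g, S.yW g) j ∧
          ∀ l < j, (S.F^[l] (g, S.yW g)).1 < γ) := by
  intro h
  have hadm : TubeAdmissibleNoAbsorption (junkStep unitRep (1 / 100) (by norm_num))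
      (1 / 1000) (1 / 10000000) := by
    refine ⟨by norm_num, by norm_num, ?_, ?_, ?_, ?_⟩ <;> norm_num [tubeTop, junkStep]
  obtain ⟨g₁, hg₁, -, hpass⟩ :=
    h Unit unitRep 2 (junkStep unitRep (1 / 100) (by norm_num)) (1 / 1000) (1 / 10000000) hadm
  set g : ℝ := min g₁ (1 / 2000) with hgdef
  have hg : g ∈ Set.Ioc 0 g₁ := ⟨lt_min hg₁ (by norm_num), min_le_left _ _⟩
  have hg2000 : g ≤ 1 / 2000 := min_le_right _ _
  obtain ⟨j, hjT, -, -⟩ := hpass g hg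
  obtain ⟨hγ, -, hρ⟩ := hjT
  cases j with
  | zero =>
    change (1 / 1000 : ℝ) ≤ g at hγ
    linarith
  | succ l =>
    rw [Function.iterate_succ_apply'] at hγ hρ
    have hinv := stallInv_orbit unitRep hg.1.le (by linarith) l
    set p := (junkStep unitRep (1 / 100) (by norm_num)).F^[l] (g, 0) with hp
    obtain ⟨hp0, -, hy0, -, -⟩ := hinv
    change (1 / 1000 : ℝ) ≤ ((junkStep unitRep (1 / 100) (by norm_num)).F (p.1, p.2)).1 at hγ
    change ‖((junkStep unitRep (1 / 100) (by norm_num)).F (p.1, p.2)).2‖ ≤ 1 / 10000000 at hρ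
    rw [junkStep_F] at hγ hρ
    change (1 / 1000 : ℝ) ≤ p.1 + p.1 ^ 3 * (1 / 100 - p.2) at hγ
    change ‖p.1 ^ 2‖ ≤ (1 / 10000000 : ℝ) at hρ
    rw [Real.norm_eq_abs, abs_of_nonneg (sq_nonneg _)] at hρ
    have hsmall : p.1 ≤ 1 / 3000 := by
      by_contra h'
      push Not at h'
      nlinarith [mul_le_mul h'.le h'.le (by norm_num) hp0]
    have hp3 := pow_le_pow_left₀ hp0 hsmall 3
    have hg3 : 0 ≤ p.1 ^ 3 := by positivity
    nlinarith [mul_nonneg hg3 hy0]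

end Thin

end TrivialGroup

end

end Summit.QuantumFields.YangMills.Theorems.LatticeGapOnTrajectory.Negative.DB
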